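import Literature.Geometry.Lorentzian.RecedingKerrLayerLabTime
import Literature.Geometry.Lorentzian.KerrHyperboloidalLeaves
import Literature.Geometry.Lorentzian.KerrConvergenceProofs
import HarnessLib

/-!
# Lab-time covariance of layer CHARTS: the lab time of a hand-over layer is absorbed by the chart

Sequel to `RecedingKerrLayerLabTime` (set- and background-level covariance). For a chart
`Φ : 𝓛_τ → 𝓢.carrier` of the `N`-hole layer at lab time `τ` and a shift `σ`, the RE-TIMED chart
`Φσ : 𝓛_{τ+σ} → 𝓢.carrier`, `Φσ x = Φ (x − σ ∂ₜ)`, has the same image, the same leaf images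
(`Φσ {s_{τ+σ} = s₀} = Φ {s_τ = s₀}`), is smooth / an open embedding if `Φ` is, and — for `Φ`
differentiable — has the translated deviation `h̃σ = h̃ ∘ (· − σ ∂ₜ)` from the (lab-time covariant)
reference background. No definitions (the re-timed chart is an explicit composite), no named facts.

References: Klainerman–Szeftel arXiv:2104.11857, §3.1, §3.6; Hawking–Ellis 1973, §5.1; Lee,
*Introduction to Smooth Manifolds*, Prop. 3.9 (`T_pU = T_pM` for open submanifolds).
-/

noncomputable section

open Set Function Filter TopologicalSpace MeasureTheory
open scoped Manifold ContDiff Topology ENNReal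

namespace Literature.Geometry.Lorentzian

namespace RecedingKerr

variable {N : ℕ} (M a : Fin N → ℝ) (Λ : Fin N → lorentzGroup) (ξ : Fin N → E3) (τ σ ℓ : ℝ)

/-- Membership transport for the re-timing map: `x ∈ 𝓛_{τ+σ} → x − σ ∂ₜ ∈ 𝓛_τ`. [folklore] -/
theorem sub_mem_layer_of_mem {x : E4} (hx : x ∈ layer M a Λ ξ (τ + σ) ℓ) :
    x - σ • E4.basisVector 0 ∈ layer M a Λ ξ τ ℓ := by
  rw [← add_mem_layer_iff M a Λ ξ τ σ ℓ, sub_add_cancel]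
  exact hx

/-- Membership transport the other way: `y ∈ 𝓛_τ → y + σ ∂ₜ ∈ 𝓛_{τ+σ}`. [folklore] -/
theorem add_mem_layer_of_mem {y : E4} (hy : y ∈ layer M a Λ ξ τ ℓ) :
    y + σ • E4.basisVector 0 ∈ layer M a Λ ξ (τ + σ) ℓ :=
  (add_mem_layer_iff M a Λ ξ τ σ ℓ).2 hy

/-- **The re-timing map `𝓛_{τ+σ} → 𝓛_τ`, `x ↦ x − σ ∂ₜ`, is smooth** (corestriction to an open
submanifold of an affine map restricted to an open submanifold;
`ChartedSpace.liftPropWithinAt_subtypeVal_comp_iff`). Lee, Prop. 3.9. [folklore] -/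
theorem contMDiff_retime :
    ContMDiff 𝓘(ℝ, E4) 𝓘(ℝ, E4) ∞
      (fun x : layer M a Λ ξ (τ + σ) ℓ ↦
        (⟨x.1 - σ • E4.basisVector 0, sub_mem_layer_of_mem M a Λ ξ τ σ ℓ x.2⟩ : layer M a Λ ξ τ ℓ)) := by
  have h : ContMDiff 𝓘(ℝ, E4) 𝓘(ℝ, E4) ∞
      (fun x : layer M a Λ ξ (τ + σ) ℓ ↦ (x.1 - σ • E4.basisVector 0 : E4)) :=
    (contDiff_id.sub contDiff_const).contMDiff.comp contMDiff_subtype_val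
  intro x
  have hiff : ContMDiffWithinAt 𝓘(ℝ, E4) 𝓘(ℝ, E4) ∞
      (Subtype.val ∘ fun x : layer M a Λ ξ (τ + σ) ℓ ↦
        (⟨x.1 - σ • E4.basisVector 0, sub_mem_layer_of_mem M a Λ ξ τ σ ℓ x.2⟩ :
          layer M a Λ ξ τ ℓ)) univ x ↔
      ContMDiffWithinAt 𝓘(ℝ, E4) 𝓘(ℝ, E4) ∞
        (fun x : layer M a Λ ξ (τ + σ) ℓ ↦
          (⟨x.1 - σ • E4.basisVector 0, sub_mem_layer_of_mem M a Λ ξ τ σ ℓ x.2⟩ :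
            layer M a Λ ξ τ ℓ)) univ x :=
    ChartedSpace.liftPropWithinAt_subtypeVal_comp_iff ..
  exact hiff.mp (h x).contMDiffWithinAt

/-- **The differential of the re-timing map is the identity** (`d(x ↦ x − σ ∂ₜ) = id`, read through
`T_x 𝓛 = E4`; `OpensChart.mfderiv_codRestrict`, `mfderiv_comp_subtypeVal'`). Lee, Prop. 3.9.
[folklore] -/
theorem mfderiv_retime_apply (x : layer M a Λ ξ (τ + σ) ℓ) (v : E4) :
    mfderiv 𝓘(ℝ, E4) 𝓘(ℝ, E4)
      (fun x : layer M a Λ ξ (τ + σ) ℓ ↦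
        (⟨x.1 - σ • E4.basisVector 0, sub_mem_layer_of_mem M a Λ ξ τ σ ℓ x.2⟩ : layer M a Λ ξ τ ℓ))
      x v = v := by
  have hd : HasFDerivAt (fun y : E4 ↦ y - σ • E4.basisVector 0) (ContinuousLinearMap.id ℝ E4) x.1 :=
    (hasFDerivAt_id x.1).sub_const _
  have h1 : mfderiv 𝓘(ℝ, E4) 𝓘(ℝ, E4)
      (fun x : layer M a Λ ξ (τ + σ) ℓ ↦ (x.1 - σ • E4.basisVector 0 : E4)) x =
        ContinuousLinearMap.id ℝ E4 := by
    rw [show (fun x : layer M a Λ ξ (τ + σ) ℓ ↦ (x.1 - σ • E4.basisVector 0 : E4)) =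
        (fun y : E4 ↦ y - σ • E4.basisVector 0) ∘ Subtype.val from rfl,
      mfderiv_comp_subtypeVal', (hasMFDerivAt_iff_hasFDerivAt.mpr hd).mfderiv]
  have hdiff : MDifferentiableAt 𝓘(ℝ, E4) 𝓘(ℝ, E4)
      (fun x : layer M a Λ ξ (τ + σ) ℓ ↦ (x.1 - σ • E4.basisVector 0 : E4)) x := by
    rw [show (fun x : layer M a Λ ξ (τ + σ) ℓ ↦ (x.1 - σ • E4.basisVector 0 : E4)) =
        (fun y : E4 ↦ y - σ • E4.basisVector 0) ∘ Subtype.val from rfl]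
    have hval : ContMDiff 𝓘(ℝ, E4) 𝓘(ℝ, E4) ∞ (Subtype.val : layer M a Λ ξ (τ + σ) ℓ → E4) :=
      contMDiff_subtype_val
    exact (hasMFDerivAt_iff_hasFDerivAt.mpr hd).mdifferentiableAt.comp x
      (hval.mdifferentiableAt (by simp))
  rw [OpensChart.mfderiv_codRestrict (fun y ↦ rfl) hdiff, h1]
  rfl

variable {𝓢 : Spacetime.{0} 4}

/-- **The re-timed chart has the same image.** [folklore] -/
theorem range_retime (Φ : layer M a Λ ξ τ ℓ → 𝓢.carrier) :
    range (fun x : layer M a Λ ξ (τ + σ) ℓ ↦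
        Φ ⟨x.1 - σ • E4.basisVector 0, sub_mem_layer_of_mem M a Λ ξ τ σ ℓ x.2⟩) = range Φ := by
  refine Set.ext fun z ↦ ⟨?_, ?_⟩
  · rintro ⟨x, rfl⟩
    exact ⟨_, rfl⟩
  · rintro ⟨y, rfl⟩
    refine ⟨⟨y.1 + σ • E4.basisVector 0, add_mem_layer_of_mem M a Λ ξ τ σ ℓ y.2⟩, ?_⟩
    simp only [add_sub_cancel_right, Subtype.coe_eta]

/-- **The re-timed chart has the same leaf images**: `Φσ {s_{τ+σ} = s₀} = Φ {s_τ = s₀}`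
(`layerTime_add`). Klainerman–Szeftel arXiv:2104.11857, §3.1. [folklore] -/
theorem image_retime_leaf (Φ : layer M a Λ ξ τ ℓ → 𝓢.carrier) (s₀ : ℝ) :
    (fun x : layer M a Λ ξ (τ + σ) ℓ ↦
        Φ ⟨x.1 - σ • E4.basisVector 0, sub_mem_layer_of_mem M a Λ ξ τ σ ℓ x.2⟩) ''
        {x | layerTime (τ + σ) ℓ x.1 = s₀} =
      Φ '' {y | layerTime τ ℓ y.1 = s₀} := by
  refine Set.ext fun z ↦ ⟨?_, ?_⟩
  · rintro ⟨x, hx, rfl⟩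
    refine ⟨_, ?_, rfl⟩
    show layerTime τ ℓ (x.1 - σ • E4.basisVector 0) = s₀
    rw [← layerTime_add τ σ ℓ, sub_add_cancel]
    exact hx
  · rintro ⟨y, hy, rfl⟩
    refine ⟨⟨y.1 + σ • E4.basisVector 0, add_mem_layer_of_mem M a Λ ξ τ σ ℓ y.2⟩, ?_, ?_⟩
    · show layerTime (τ + σ) ℓ (y.1 + σ • E4.basisVector 0) = s₀
      rw [layerTime_add]
      exact hy
    · simp only [add_sub_cancel_right, Subtype.coe_eta]

/-- **The re-timed chart of a smooth chart is smooth.** [folklore] -/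
theorem contMDiff_retime_comp {Φ : layer M a Λ ξ τ ℓ → 𝓢.carrier}
    (hΦ : ContMDiff 𝓘(ℝ, E4) (𝓡 4) ∞ Φ) :
    ContMDiff 𝓘(ℝ, E4) (𝓡 4) ∞ (fun x : layer M a Λ ξ (τ + σ) ℓ ↦
        Φ ⟨x.1 - σ • E4.basisVector 0, sub_mem_layer_of_mem M a Λ ξ τ σ ℓ x.2⟩) :=
  hΦ.comp (contMDiff_retime M a Λ ξ τ σ ℓ)

/-- **The re-timed chart of an open embedding is an open embedding** (the re-timing map is a
homeomorphism `𝓛_{τ+σ} ≃ₜ 𝓛_τ`, being the restriction of the translation homeomorphism of `E4`).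
[folklore] -/
theorem isOpenEmbedding_retime_comp {Φ : layer M a Λ ξ τ ℓ → 𝓢.carrier}
    (hΦ : Topology.IsOpenEmbedding Φ) :
    Topology.IsOpenEmbedding (fun x : layer M a Λ ξ (τ + σ) ℓ ↦
        Φ ⟨x.1 - σ • E4.basisVector 0, sub_mem_layer_of_mem M a Λ ξ τ σ ℓ x.2⟩) := by
  -- the re-timing map as a homeomorphism between the two layers
  let e : layer M a Λ ξ (τ + σ) ℓ ≃ₜ layer M a Λ ξ τ ℓ :=
    { toFun := fun x ↦ ⟨x.1 - σ • E4.basisVector 0, sub_mem_layer_of_mem M a Λ ξ τ σ ℓ x.2⟩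
      invFun := fun y ↦ ⟨y.1 + σ • E4.basisVector 0, add_mem_layer_of_mem M a Λ ξ τ σ ℓ y.2⟩
      left_inv := fun x ↦ Subtype.ext (sub_add_cancel _ _)
      right_inv := fun y ↦ Subtype.ext (add_sub_cancel_right _ _)
      continuous_toFun := (continuous_subtype_val.sub continuous_const).subtype_mk _
      continuous_invFun := (continuous_subtype_val.add continuous_const).subtype_mk _ }
  exact hΦ.comp e.isOpenEmbedding

/-! ### Translated functions on the layer: the three parts of the norm are lab-time covariant -/

section Parts

variable {G : Type*} [NormedAddCommGroup G] [NormedSpace ℝ G]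

/-- Time translation by `σ ∂ₜ` on `E4`, subtraction form: `(y − σ ∂ₜ)̲ = y̲`. [folklore] -/
theorem spatial_sub_smul_basisVector_zero (y : E4) :
    E4.spatial (y - σ • E4.basisVector 0) = E4.spatial y := by
  rw [sub_eq_add_neg, ← neg_smul, E4.spatial_add_smul_basisVector_zero]

/-- `|(y − σ ∂ₜ)̲| = |y̲|`. [folklore] -/
theorem spatialNorm_sub_smul_basisVector_zero (y : E4) :
    E4.spatialNorm (y - σ • E4.basisVector 0) = E4.spatialNorm y := by
  rw [E4.spatialNorm, E4.spatialNorm, spatial_sub_smul_basisVector_zero]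

/-- Membership transport for the near part. [folklore] -/
theorem sub_mem_nearLayer_iff {y : E4} :
    y - σ • E4.basisVector 0 ∈ nearLayer M a Λ ξ τ ℓ ↔ y ∈ nearLayer M a Λ ξ (τ + σ) ℓ := by
  rw [← add_mem_nearLayer_iff M a Λ ξ τ σ ℓ, sub_add_cancel]

/-- Membership transport for the far part. [folklore] -/
theorem sub_mem_farLayer_iff {y : E4} :
    y - σ • E4.basisVector 0 ∈ farLayer M a Λ ξ τ ℓ ↔ y ∈ farLayer M a Λ ξ (τ + σ) ℓ := by
  rw [← add_mem_farLayer_iff M a Λ ξ τ σ ℓ, sub_add_cancel]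

/-- **(a) The near `Cᵏ` norm is lab-time covariant**: translating the function by `σ ∂ₜ` and
the near layer by the same amount does not change the weighted sup norm
(`iteratedFDeriv_comp_sub`; the weights `σ^m` do not depend on `τ`). Klainerman–Szeftel
arXiv:2104.11857, §3.6. [folklore] -/
theorem nearCkNorm_comp_sub (k : ℕ) (f : E4 → G) :
    nearCkNorm M a Λ ξ (τ + σ) ℓ k (fun y ↦ f (y - σ • E4.basisVector 0)) =
      nearCkNorm M a Λ ξ τ ℓ k f := by
  unfold nearCkNorm
  refine Finset.sum_congr rfl fun m _ ↦ ?_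
  congr 1
  simp only [iteratedFDeriv_comp_sub]
  refine le_antisymm (iSup₂_le fun y hy ↦ ?_) (iSup₂_le fun x hx ↦ ?_)
  · exact le_iSup₂_of_le (y - σ • E4.basisVector 0)
      ((sub_mem_nearLayer_iff M a Λ ξ τ σ ℓ).2 hy) le_rfl
  · refine le_iSup₂_of_le (x + σ • E4.basisVector 0)
      ((add_mem_nearLayer_iff M a Λ ξ τ σ ℓ).2 hx) ?_
    rw [add_sub_cancel_right]

/-- The flat outgoing null vector depends on the spatial part only. [folklore] -/
theorem outgoingNull_sub_smul_basisVector_zero (y : E4) :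
    Minkowski.outgoingNull (y - σ • E4.basisVector 0) = Minkowski.outgoingNull y := by
  simp only [Minkowski.outgoingNull, Minkowski.radialUnit, spatial_sub_smul_basisVector_zero,
    spatialNorm_sub_smul_basisVector_zero]

/-- The flat ingoing null vector depends on the spatial part only. [folklore] -/
theorem ingoingNull_sub_smul_basisVector_zero (y : E4) :
    Minkowski.ingoingNull (y - σ • E4.basisVector 0) = Minkowski.ingoingNull y := by
  simp only [Minkowski.ingoingNull, Minkowski.radialUnit, spatial_sub_smul_basisVector_zero,
    spatialNorm_sub_smul_basisVector_zero]

/-- The rotation fields depend on the spatial part only. [folklore] -/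
theorem rotation_sub_smul_basisVector_zero (i j : Fin 3) (y : E4) :
    Minkowski.rotation i j (y - σ • E4.basisVector 0) = Minkowski.rotation i j y := by
  simp only [Minkowski.rotation, spatial_sub_smul_basisVector_zero]

/-- `d(ψ ∘ (· − c))_y = dψ_{y − c}`. [folklore] -/
theorem fderiv_comp_sub_smul (ψ : E4 → G) (y : E4) :
    fderiv ℝ (fun z ↦ ψ (z - σ • E4.basisVector 0)) y =
      fderiv ℝ ψ (y - σ • E4.basisVector 0) := by
  have h : (fun z ↦ ψ (z - σ • E4.basisVector 0)) = fun z ↦ ψ (z + -(σ • E4.basisVector 0)) := by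
    funext z
    rw [sub_eq_add_neg]
  rw [h, fderiv_comp_add_right, ← sub_eq_add_neg]

/-- The radiation field of a translated function is the translated radiation field (the weight
`|y̲|` is translation invariant). [folklore] -/
theorem radiationField_comp_sub (g : E4 → G) :
    Minkowski.radiationField (fun z ↦ g (z - σ • E4.basisVector 0)) =
      fun y ↦ Minkowski.radiationField g (y - σ • E4.basisVector 0) := by
  funext y
  simp only [Minkowski.radiationField, spatialNorm_sub_smul_basisVector_zero]

/-- The squared angular gradient of a translated function is the translated one. [folklore] -/
theorem angularGradSq_comp_sub (ψ : E4 → G) (y : E4) :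
    Minkowski.angularGradSq (fun z ↦ ψ (z - σ • E4.basisVector 0)) y =
      Minkowski.angularGradSq ψ (y - σ • E4.basisVector 0) := by
  simp only [Minkowski.angularGradSq, fderiv_comp_sub_smul, rotation_sub_smul_basisVector_zero,
    spatialNorm_sub_smul_basisVector_zero]

/-- The `r^p` flux density of a translated function is the translated density. [folklore] -/
theorem rpFluxDensity_comp_sub (p : ℝ) (ψ : E4 → G) (y : E4) :
    Minkowski.rpFluxDensity p (fun z ↦ ψ (z - σ • E4.basisVector 0)) y =
      Minkowski.rpFluxDensity p ψ (y - σ • E4.basisVector 0) := by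
  simp only [Minkowski.rpFluxDensity, fderiv_comp_sub_smul, angularGradSq_comp_sub,
    outgoingNull_sub_smul_basisVector_zero, spatialNorm_sub_smul_basisVector_zero]

/-- The transversal flux density of a translated function is the translated density. [folklore] -/
theorem transversalFluxDensity_comp_sub (δ : ℝ) (ψ : E4 → G) (y : E4) :
    Minkowski.transversalFluxDensity δ (fun z ↦ ψ (z - σ • E4.basisVector 0)) y =
      Minkowski.transversalFluxDensity δ ψ (y - σ • E4.basisVector 0) := by
  simp only [Minkowski.transversalFluxDensity, fderiv_comp_sub_smul,
    ingoingNull_sub_smul_basisVector_zero, spatialNorm_sub_smul_basisVector_zero]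

/-- The far part of the layer is a measurable set (open layer meets closed `{ℓ ≤ |x̲|}`).
[folklore] -/
theorem measurableSet_farLayer : MeasurableSet (farLayer M a Λ ξ τ ℓ) := by
  have h1 : MeasurableSet (layer M a Λ ξ τ ℓ : Set E4) := (layer M a Λ ξ τ ℓ).isOpen.measurableSet
  have h2 : MeasurableSet {x : E4 | ℓ ≤ E4.spatialNorm x} :=
    measurableSet_le measurable_const (by unfold E4.spatialNorm; fun_prop)
  rw [show farLayer M a Λ ξ τ ℓ = (layer M a Λ ξ τ ℓ : Set E4) ∩ {x : E4 | ℓ ≤ E4.spatialNorm x} from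
    Set.ext fun x ↦ Iff.rfl]
  exact h1.inter h2

/-- **Translation invariance of far-layer integrals**: for `F : E4 → ℝ≥0∞`,
`∫_{far 𝓛_{τ+σ}} F(y − σ ∂ₜ) dy = ∫_{far 𝓛_τ} F(x) dx` (Lebesgue measure on `E4` is translation
invariant, `lintegral_sub_right_eq_self`). [folklore] -/
theorem setLIntegral_farLayer_comp_sub (F : E4 → ℝ≥0∞) :
    ∫⁻ y in farLayer M a Λ ξ (τ + σ) ℓ, F (y - σ • E4.basisVector 0) =
      ∫⁻ x in farLayer M a Λ ξ τ ℓ, F x := by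
  rw [← lintegral_indicator (measurableSet_farLayer M a Λ ξ (τ + σ) ℓ),
    ← lintegral_indicator (measurableSet_farLayer M a Λ ξ τ ℓ),
    ← lintegral_sub_right_eq_self (μ := (volume : Measure E4))
      ((farLayer M a Λ ξ τ ℓ).indicator F) (σ • E4.basisVector 0)]
  refine lintegral_congr fun y ↦ ?_
  by_cases hy : y ∈ farLayer M a Λ ξ (τ + σ) ℓ
  · rw [Set.indicator_of_mem hy, Set.indicator_of_mem ((sub_mem_farLayer_iff M a Λ ξ τ σ ℓ).2 hy)]
  · rw [Set.indicator_of_notMem hy,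
      Set.indicator_of_notMem (mt (sub_mem_farLayer_iff M a Λ ξ τ σ ℓ).1 hy)]

/-- **(b) The `r^p` flux is lab-time covariant.** Dafermos–Rodnianski arXiv:0910.4957, §3.
[folklore] -/
theorem rpFlux_comp_sub (k : ℕ) (p : ℝ) (f : E4 → G) :
    rpFlux M a Λ ξ (τ + σ) ℓ k p (fun y ↦ f (y - σ • E4.basisVector 0)) =
      rpFlux M a Λ ξ τ ℓ k p f := by
  unfold rpFlux
  refine Finset.sum_congr rfl fun m _ ↦ ?_
  congr 1
  rw [iteratedFDeriv_comp_sub', radiationField_comp_sub,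
    ← setLIntegral_farLayer_comp_sub M a Λ ξ τ σ ℓ]
  refine setLIntegral_congr_fun (measurableSet_farLayer M a Λ ξ (τ + σ) ℓ) fun y _ ↦ ?_
  rw [rpFluxDensity_comp_sub, spatialNorm_sub_smul_basisVector_zero]

/-- **(c) The transversal flux is lab-time covariant.** DHRT arXiv:2104.08222, Ch. 8 §1.4.
[folklore] -/
theorem transversalFlux_comp_sub (k : ℕ) (δ : ℝ) (f : E4 → G) :
    transversalFlux M a Λ ξ (τ + σ) ℓ k δ (fun y ↦ f (y - σ • E4.basisVector 0)) =
      transversalFlux M a Λ ξ τ ℓ k δ f := by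
  unfold transversalFlux
  refine Finset.sum_congr rfl fun m _ ↦ ?_
  congr 1
  rw [iteratedFDeriv_comp_sub', radiationField_comp_sub,
    ← setLIntegral_farLayer_comp_sub M a Λ ξ τ σ ℓ]
  refine setLIntegral_congr_fun (measurableSet_farLayer M a Λ ξ (τ + σ) ℓ) fun y _ ↦ ?_
  rw [transversalFluxDensity_comp_sub, spatialNorm_sub_smul_basisVector_zero]

end Parts

/-! ### The deviation and the norm of the re-timed chart -/

/-- **The deviation of the re-timed chart is the re-timed deviation**: for `Φ` differentiable,
`(Φσ^* g − G_{τ+σ})(x) = (Φ^* g − G_τ)(x − σ ∂ₜ)` (chain rule with `d(retime) = id`; background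
covariance `background_bilin_add`). Klainerman–Szeftel arXiv:2104.11857, §3.6. [folklore] -/
theorem deviation_retime {Φ : layer M a Λ ξ τ ℓ → 𝓢.carrier}
    (hΦ : MDifferentiable 𝓘(ℝ, E4) (𝓡 4) Φ) (x : layer M a Λ ξ (τ + σ) ℓ) :
    𝓢.deviation (background M a Λ ξ (τ + σ) ℓ)
        (fun x : layer M a Λ ξ (τ + σ) ℓ ↦
          Φ ⟨x.1 - σ • E4.basisVector 0, sub_mem_layer_of_mem M a Λ ξ τ σ ℓ x.2⟩) x =
      𝓢.deviation (background M a Λ ξ τ ℓ) Φ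
        ⟨x.1 - σ • E4.basisVector 0, sub_mem_layer_of_mem M a Λ ξ τ σ ℓ x.2⟩ := by
  set R : layer M a Λ ξ (τ + σ) ℓ → layer M a Λ ξ τ ℓ :=
    fun x ↦ ⟨x.1 - σ • E4.basisVector 0, sub_mem_layer_of_mem M a Λ ξ τ σ ℓ x.2⟩ with hR
  have hRd : MDifferentiableAt 𝓘(ℝ, E4) 𝓘(ℝ, E4) R x :=
    (contMDiff_retime M a Λ ξ τ σ ℓ).mdifferentiableAt (by simp)
  have hcomp : mfderiv 𝓘(ℝ, E4) (𝓡 4) (Φ ∘ R) x = (mfderiv 𝓘(ℝ, E4) (𝓡 4) Φ (R x)).comp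
      (mfderiv 𝓘(ℝ, E4) 𝓘(ℝ, E4) R x) := mfderiv_comp x (hΦ (R x)) hRd
  have hv : ∀ v : E4, mfderiv 𝓘(ℝ, E4) (𝓡 4) (Φ ∘ R) x v = mfderiv 𝓘(ℝ, E4) (𝓡 4) Φ (R x) v := by
    intro v
    rw [hcomp]
    exact congrArg (mfderiv 𝓘(ℝ, E4) (𝓡 4) Φ (R x)) (mfderiv_retime_apply M a Λ ξ τ σ ℓ x v)
  ext v w
  rw [Spacetime.deviation_apply, Spacetime.deviation_apply]
  change 𝓢.metric.val (Φ (R x)) (mfderiv 𝓘(ℝ, E4) (𝓡 4) (Φ ∘ R) x v)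
      (mfderiv 𝓘(ℝ, E4) (𝓡 4) (Φ ∘ R) x w) - (background M a Λ ξ (τ + σ) ℓ).bilin x.1 v w =
    𝓢.metric.val (Φ (R x)) (mfderiv 𝓘(ℝ, E4) (𝓡 4) Φ (R x) v)
      (mfderiv 𝓘(ℝ, E4) (𝓡 4) Φ (R x) w) - (background M a Λ ξ τ ℓ).bilin (R x).1 v w
  rw [hv, hv]
  congr 1
  have hb := background_bilin_add M a Λ ξ τ σ ℓ (x.1 - σ • E4.basisVector 0)
  rw [sub_add_cancel] at hb
  rw [hb]

/-- **The extended deviation of the re-timed chart is the translated extended deviation**: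
`h̃σ = h̃ ∘ (· − σ ∂ₜ)` on all of `E4` (on the layer by `deviation_retime`, off it both are the junk
value `0`). [folklore] -/
theorem deviationExtend_retime {Φ : layer M a Λ ξ τ ℓ → 𝓢.carrier}
    (hΦ : MDifferentiable 𝓘(ℝ, E4) (𝓡 4) Φ) :
    𝓢.deviationExtend (background M a Λ ξ (τ + σ) ℓ)
        (fun x : layer M a Λ ξ (τ + σ) ℓ ↦
          Φ ⟨x.1 - σ • E4.basisVector 0, sub_mem_layer_of_mem M a Λ ξ τ σ ℓ x.2⟩) =
      fun y ↦ 𝓢.deviationExtend (background M a Λ ξ τ ℓ) Φ (y - σ • E4.basisVector 0) := by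
  funext y
  by_cases hy : y ∈ layer M a Λ ξ (τ + σ) ℓ
  · have h1 := 𝓢.deviationExtend_coe (background M a Λ ξ (τ + σ) ℓ)
      (fun x : layer M a Λ ξ (τ + σ) ℓ ↦
        Φ ⟨x.1 - σ • E4.basisVector 0, sub_mem_layer_of_mem M a Λ ξ τ σ ℓ x.2⟩) ⟨y, hy⟩
    have h2 := 𝓢.deviationExtend_coe (background M a Λ ξ τ ℓ) Φ
      ⟨y - σ • E4.basisVector 0, sub_mem_layer_of_mem M a Λ ξ τ σ ℓ hy⟩
    rw [deviation_retime M a Λ ξ τ σ ℓ hΦ] at h1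
    exact h1.trans h2.symm
  · rw [𝓢.deviationExtend_of_not_mem (background M a Λ ξ (τ + σ) ℓ) _ hy,
      𝓢.deviationExtend_of_not_mem (background M a Λ ξ τ ℓ) _
        (mt (add_mem_layer_iff M a Λ ξ τ σ ℓ).2 (by rwa [sub_add_cancel]))]

/-- **THE LAYER NORM IS LAB-TIME COVARIANT**: the re-timed chart `Φσ` of a differentiable chart
`Φ` of the layer at lab time `τ` is a chart of the layer at lab time `τ + σ` with
`𝔑_(k,p,δ)(Φσ) = 𝔑_(k,p,δ)(Φ)`. Klainerman–Szeftel arXiv:2104.11857, §3.6; Dafermos–Rodnianski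
arXiv:0910.4957, §3. [folklore] -/
theorem recedingKerrInitialLayerNorm_retime {Φ : layer M a Λ ξ τ ℓ → 𝓢.carrier}
    (hΦ : MDifferentiable 𝓘(ℝ, E4) (𝓡 4) Φ) (k : ℕ) (p δ : ℝ) :
    𝓢.recedingKerrInitialLayerNorm M a Λ ξ (τ + σ) ℓ k p δ
        (fun x : layer M a Λ ξ (τ + σ) ℓ ↦
          Φ ⟨x.1 - σ • E4.basisVector 0, sub_mem_layer_of_mem M a Λ ξ τ σ ℓ x.2⟩) =
      𝓢.recedingKerrInitialLayerNorm M a Λ ξ τ ℓ k p δ Φ := by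
  rw [Spacetime.recedingKerrInitialLayerNorm_eq, Spacetime.recedingKerrInitialLayerNorm_eq,
    deviationExtend_retime M a Λ ξ τ σ ℓ hΦ, nearCkNorm_comp_sub, rpFlux_comp_sub,
    transversalFlux_comp_sub]

/-! ### The lab time of a layer chart is idle -/

/-- **Any layer chart at lab time `τ` re-times to every lab time**: if the layer at lab time `τ`
carries a smooth open embedding into `𝓢` with image in a set `J`, achronal leaves (for a notion
`A` of achronality of subsets of `𝓢`) and norm `≤ η`, then so does the layer at every lab time
`τ'` (`τ' = τ + (τ' − τ)`), with the same image. Consequently in a clause "`∀ τ₁, ∃ τ ≥ τ₁`, such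
a chart at lab time `τ`" the quantification over `τ` is idle. Klainerman–Szeftel arXiv:2104.11857,
§3.1. [folklore] -/
theorem exists_layerChart_at_of_exists {J : Set 𝓢.carrier} {A : Set 𝓢.carrier → Prop} {k : ℕ}
    {p δ : ℝ} {η : ℝ≥0∞} (τ' : ℝ)
    (h : ∃ Φ : layer M a Λ ξ τ ℓ → 𝓢.carrier,
      ContMDiff 𝓘(ℝ, E4) (𝓡 4) ∞ Φ ∧ Topology.IsOpenEmbedding Φ ∧ range Φ ⊆ J ∧
        (∀ s₀ ∈ Ioo 0 ℓ, A (Φ '' {x | layerTime τ ℓ x.1 = s₀})) ∧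
          𝓢.recedingKerrInitialLayerNorm M a Λ ξ τ ℓ k p δ Φ ≤ η) :
    ∃ Ψ : layer M a Λ ξ τ' ℓ → 𝓢.carrier,
      ContMDiff 𝓘(ℝ, E4) (𝓡 4) ∞ Ψ ∧ Topology.IsOpenEmbedding Ψ ∧ range Ψ ⊆ J ∧
        (∀ s₀ ∈ Ioo 0 ℓ, A (Ψ '' {x | layerTime τ' ℓ x.1 = s₀})) ∧
          𝓢.recedingKerrInitialLayerNorm M a Λ ξ τ' ℓ k p δ Ψ ≤ η := by
  obtain ⟨Φ, hs, ho, hr, ha, hn⟩ := h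
  obtain ⟨σ, rfl⟩ : ∃ σ, τ' = τ + σ := ⟨τ' - τ, by ring⟩
  refine ⟨fun x : layer M a Λ ξ (τ + σ) ℓ ↦
      Φ ⟨x.1 - σ • E4.basisVector 0, sub_mem_layer_of_mem M a Λ ξ τ σ ℓ x.2⟩,
    contMDiff_retime_comp M a Λ ξ τ σ ℓ hs, isOpenEmbedding_retime_comp M a Λ ξ τ σ ℓ ho,
    (range_retime M a Λ ξ τ σ ℓ Φ).symm ▸ hr, fun s₀ hs₀ ↦ ?_, ?_⟩
  · rw [image_retime_leaf]
    exact ha s₀ hs₀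
  · rw [recedingKerrInitialLayerNorm_retime M a Λ ξ τ σ ℓ (hs.mdifferentiable (by simp))]
    exact hn

end RecedingKerr

end Literature.Geometry.Lorentzian

end
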